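import Summits.ResolutionOfSingularities.ResolutionOfSingularities.Theorems.FrobeniusClosingPatchingRelPerfectMonomialSumPairs
import HarnessLib

/-!
# Crux `PatchingRelPerfect` (stmt-ResolutionOfSingularities-16161), chain w52 — R4ˢ END-GAME input, every
# depth `ℓ`: principalization of `monomialIdeal A ⊔ 𝓘_E^ℓ` (by content, fact-free)

[OURS · L1 W5.2 · R4ˢ-pure «END-GAME / M2» for general `ℓ`] res-L1-w52-plan-1's reading (STEER 05:42:24Z):
«for general `ℓ` the end-game is M2 with `𝒦 = [exponents of r^*𝔟′, (𝓘_{E′}, ℓ)]`» — a TWO-member family, so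
the pair theorem applies with centres over the cosupport `V(r^*𝔟′) ∩ E′` (over the closed point).  This
file packages it in the shape the assembly consumes, with NO `Nodup` hypothesis on the boundary:

* `singleExp A E ℓ` — the exponent list on the boundary of `A` carrying `ℓ` at the FIRST occurrence of `E`
  and `0` elsewhere; `boundaryOf_singleExp` (same boundary as `A`), `monomialIdeal_singleExp`
  (`= E ^ ℓ` when `E ∈ boundaryOf A`);
* **`exists_centreSeq_principalize_sup_pow`** — for an exponent list `A` on a simple normal crossings
  boundary containing `E`: a `CentreSeq` with regular centres over `V(monomialIdeal A ⊔ E^ℓ)`, regular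
  top, and `π^*(monomialIdeal A ⊔ E^ℓ)` locally principal (from
  `MonomialCleanup.exists_centreSeq_isLocallyPrincipal_comap`, p500388); F3 vocabulary:
  `monomialSum [A, singleExp A E ℓ]`.

Any dimension; nothing here is a statement of the manuscript under review.

## References

* J. Kollár, *Lectures on Resolution of Singularities* (2007), (3.111) Step 3. [Kollar2007]
* R. Goward, *A simple algorithm for principalization of monomial ideals*, Trans. AMS 357 (2005).
  [Goward2005]
-/

-- `Summit.<Summit>.<Sub>.Theorems` with `Sub = Summit` (single-conjunct summit, D-0017)
set_option linter.dupNamespace false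

noncomputable section

open CategoryTheory AlgebraicGeometry TopologicalSpace
open Literature.AlgebraicGeometry.Resolution

namespace Summit.ResolutionOfSingularities.ResolutionOfSingularities.Theorems

namespace MonomialCleanup

universe u

variable {X : Scheme.{u}}

/-- **The exponent list `E ↦ ℓ` (first occurrence), everything else `↦ 0`, on the boundary of `A`.**
[folklore] -/
def singleExp (A : List (X.IdealSheafData × ℕ)) (E : X.IdealSheafData) (ℓ : ℕ) :
    List (X.IdealSheafData × ℕ) :=
  match A with
  | [] => []
  | p :: t => by
    classical
    exact if p.1 = E then (p.1, ℓ) :: t.map (fun q => (q.1, 0)) else (p.1, 0) :: singleExp t E ℓ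

/-- Unfolding on the empty list. [folklore] -/
@[simp] theorem singleExp_nil (E : X.IdealSheafData) (ℓ : ℕ) : singleExp ([] : List (X.IdealSheafData × ℕ)) E ℓ = [] :=
  rfl

/-- Unfolding on a cons whose head is `E`. [folklore] -/
theorem singleExp_cons_of_eq {p : X.IdealSheafData × ℕ} (t : List (X.IdealSheafData × ℕ)) {E : X.IdealSheafData}
    (h : p.1 = E) (ℓ : ℕ) : singleExp (p :: t) E ℓ = (p.1, ℓ) :: t.map (fun q => (q.1, 0)) := by
  classical
  simp [singleExp, h]

/-- Unfolding on a cons whose head is not `E`. [folklore] -/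
theorem singleExp_cons_of_ne {p : X.IdealSheafData × ℕ} (t : List (X.IdealSheafData × ℕ)) {E : X.IdealSheafData}
    (h : p.1 ≠ E) (ℓ : ℕ) : singleExp (p :: t) E ℓ = (p.1, 0) :: singleExp t E ℓ := by
  classical
  simp [singleExp, h]

/-- A list of zero exponents has the unit monomial ideal. [folklore] -/
theorem monomialIdeal_map_zero (t : List (X.IdealSheafData × ℕ)) :
    monomialIdeal (t.map fun q => (q.1, 0)) = ⊤ := by
  induction t with
  | nil => simp
  | cons q t ih => rw [List.map_cons, monomialIdeal_cons, ih, pow_zero, Scheme.IdealSheafData.one_eq_top,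
      Scheme.IdealSheafData.top_mul]

/-- `singleExp` lives on the boundary of `A`. [folklore] -/
theorem boundaryOf_singleExp (A : List (X.IdealSheafData × ℕ)) (E : X.IdealSheafData) (ℓ : ℕ) :
    boundaryOf (singleExp A E ℓ) = boundaryOf A := by
  induction A with
  | nil => rfl
  | cons p t ih =>
    by_cases h : p.1 = E
    · rw [singleExp_cons_of_eq t h]
      simp [boundaryOf, List.map_map, Function.comp_def]
    · rw [singleExp_cons_of_ne t h]
      simp only [boundaryOf, List.map_cons] at ih ⊢
      rw [ih]

/-- **`monomialIdeal (singleExp A E ℓ) = E ^ ℓ`** when `E` is a boundary divisor of `A`. [folklore] -/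
theorem monomialIdeal_singleExp {A : List (X.IdealSheafData × ℕ)} {E : X.IdealSheafData}
    (hE : E ∈ boundaryOf A) (ℓ : ℕ) : monomialIdeal (singleExp A E ℓ) = E ^ ℓ := by
  induction A with
  | nil => simp [boundaryOf] at hE
  | cons p t ih =>
    by_cases h : p.1 = E
    · rw [singleExp_cons_of_eq t h, monomialIdeal_cons, monomialIdeal_map_zero, Scheme.IdealSheafData.mul_top, h]
    · rw [singleExp_cons_of_ne t h, monomialIdeal_cons, pow_zero, Scheme.IdealSheafData.one_eq_top,
        Scheme.IdealSheafData.top_mul]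
      refine ih ?_
      rcases mem_boundaryOf_iff.mp hE with ⟨a, ha⟩
      rcases List.mem_cons.mp ha with hpa | hta
      · exact absurd (congrArg Prod.fst hpa).symm h
      · exact mem_boundaryOf_iff.mpr ⟨a, hta⟩

/-- **Principalization of `monomialIdeal A ⊔ E^ℓ`** (the M2 input of the depth-`ℓ` END-GAME in the
retraction model, `K = r^*𝔟′ ⊔ 𝓘_{E′}^ℓ`): for an exponent list `A` on a simple normal crossings boundary
containing `E`, on a locally Noetherian scheme, there is a `CentreSeq` with regular centres over
`V(monomialIdeal A ⊔ E^ℓ)` (inside `V(E)`), regular top, and locally principal total transform.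
[cite: Goward2005, §2] [cite: Kollar2007, (3.111) Step 3] -/
theorem exists_centreSeq_principalize_sup_pow [IsLocallyNoetherian X] (A : List (X.IdealSheafData × ℕ))
    (hA : HasSNC (boundaryOf A)) {E : X.IdealSheafData} (hE : E ∈ boundaryOf A) (ℓ : ℕ) :
    ∃ s : CentreSeq X, s.AllRegular ∧
      s.CentresOver ((monomialIdeal A ⊔ E ^ ℓ).support : Set X) ∧ Scheme.IsRegular s.top ∧
      IsLocallyPrincipal ((monomialIdeal A ⊔ E ^ ℓ).comap s.comp) := by
  have h := exists_centreSeq_isLocallyPrincipal_comap A (singleExp A E ℓ) (boundaryOf_singleExp A E ℓ).symm hA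
  rwa [monomialIdeal_singleExp hE] at h

/-- The same in the F3 vocabulary: `monomialSum [A, singleExp A E ℓ] = monomialIdeal A ⊔ E^ℓ`. [folklore] -/
theorem monomialSum_pair_singleExp {A : List (X.IdealSheafData × ℕ)} {E : X.IdealSheafData}
    (hE : E ∈ boundaryOf A) (ℓ : ℕ) :
    DepthTargets.monomialSum [A, singleExp A E ℓ] = monomialIdeal A ⊔ E ^ ℓ := by
  rw [DepthTargets.monomialSum_pair, monomialIdeal_singleExp hE]

end MonomialCleanup

end Summit.ResolutionOfSingularities.ResolutionOfSingularities.Theorems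

end
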